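import Mathlib
import Summits.KontsevichZagierPeriods.Zeta5Search.Families.DualGapSeries
import HarnessLib

/-!
# ζ(5) search — Families: the FLIP-STEP ENGINE for the base identity — constant-term triviality of a torus chart
# propagates along an elementary ("cluster flip") change of chart

HONEST FRAMING: systematic search; no irrationality claim unless certified.  Cell `pub-zeta5`, certifier 2
(cert-2 g8, 2026-08-22).  Pure algebra in the power-series ring `ℤ[[r₁,…,r₅]]` of `Families/DualGapSeries` (p313079);
no conjecture node is used; nothing about `ζ(5)`; no number of record moves.

WHY.  cert-2 g8 reduced CONJECTURE D-exact in the kernel to `DualBaseIdentity` (`Families/DualExactTwelve`,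
`Families/DualExactBridge`): `CT_r[x(r)^s] = [s = 0]` for every Laurent monomial `x^s` in Brown–Zudilin's five residue
coordinates expressed in the gap ratios `r` — the monomial case of a volume-preserving change of torus chart.  That chart
is reached from the `r`-chart (the fan triangulation of the octagon at `w₇ = ∞`) by SIX elementary steps (five flips
`17→02, 37→24, 57→46, 27→04, 47→06` to the triangulation `T_c = {02,24,04,46,06}` and one flip `04→26` taken on two
coordinates only; exact data `HOME/cert-2/g8/code/e10_flips.py`), and at each step the new coordinates are
`Y_j = ±X^{μ_j}·(1 + w)^{a_j}` with `w = X^ρ` a SMALL monomial of the old chart.  This file proves the two generic facts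
that make such a chain a kernel proof:
* **`coeffZ_zpow_mul_eq_zero`** (TRANSFER LEMMA): if `U = 1 + r^α·W` (`α ∈ ℕ⁵∖{0}`, any `W`) and every shifted
  coefficient `[r^{c − iα}](W^i·F)` vanishes (`i ≥ 0`), then `[r^c](U^N·F) = 0` for EVERY `N ∈ ℤ` (for `N < 0` through the
  finite geometric identity `U⁻¹ = Σ_{i<K}(−r^αW)^i + (−r^αW)^K·U⁻¹` and the fact that a coefficient at an exponent with a
  negative entry is `0` — no binomial series, no topology);
* **`ctTrivial_step`** (STEP THEOREM): let a chart be given by an additive exponent map `γ : ℤ⁵ → ℤ⁵` and a multiplicative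
  unit part `V : ℤ⁵ → ℤ[[r]]ˣ` (so the chart monomials are `X^s = r^{γ s}·V s`), and suppose it is CT-TRIVIAL:
  `[r^{−γ s}](V s) = 0` for all `s ≠ 0`.  Let `ρ` with `γρ ≥ 0`, `γρ ≠ 0` (so `w = X^ρ ∈ ℤ[[r]]` is small), `μ` an
  injective additive map, `a` additive, with the FLIP CONDITION `μ s + i•ρ = 0, i ≥ 1 ⇒ a s = 0`.  Then the new chart
  `Y^s = X^{μ s}·(1 + w)^{a s}` is CT-trivial: `[r^{−γ(μ s)}](V(μ s)·U^{a s}) = 0` for all `s ≠ 0`.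
The `r`-chart itself (`γ = id`, `V = 1`) is CT-trivial (`ctTrivial_id`).  What remains for `DualBaseIdentity` is pure
bookkeeping: six instantiations (the unit identities behind each flip are Plücker relations like `DualR.uPoly_rel*`).
-/

noncomputable section

open MvPowerSeries Finset

namespace Summit.KontsevichZagierPeriods.Zeta5Search.Families.Cellular

namespace DualR

/-! ## Coefficients at integer exponents: monomial shifts, negation, vanishing -/

/-- The integer exponent vector of a monomial exponent. -/
def zOf (α : Fin 5 →₀ ℕ) : Fin 5 → ℤ := fun j => (α j : ℤ)

/-- `coeffZ c φ = 0` as soon as one target exponent is negative. -/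
theorem coeffZ_eq_zero_of_neg {c : Fin 5 → ℤ} (φ : S5) {j : Fin 5} (hj : c j < 0) : coeffZ c φ = 0 := by
  unfold coeffZ; rw [if_neg]; intro h; have := h j; omega

/-- **Monomial shift**: `[r^c](r^α · φ) = [r^{c − α}] φ`. -/
theorem coeffZ_monomial_mul (c : Fin 5 → ℤ) (α : Fin 5 →₀ ℕ) (φ : S5) :
    coeffZ c (monomial α (1 : ℤ) * φ) = coeffZ (c - zOf α) φ := by
  unfold coeffZ
  by_cases h : ∀ j, 0 ≤ c j
  · rw [if_pos h, coeff_monomial_mul]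
    by_cases hle : α ≤ Finsupp.equivFunOnFinite.symm fun j => (c j).toNat
    · have hle' : ∀ j, (α j : ℤ) ≤ c j := fun j => by
        have := hle j; simp only [Finsupp.coe_equivFunOnFinite_symm] at this; have := h j; omega
      have h' : ∀ j, 0 ≤ (c - zOf α) j := fun j => by simp only [Pi.sub_apply, zOf]; have := hle' j; omega
      rw [if_pos hle, if_pos h', one_mul]
      have hidx : (Finsupp.equivFunOnFinite.symm fun j => (c j).toNat) - α =
          Finsupp.equivFunOnFinite.symm fun j => ((c - zOf α) j).toNat := by
        ext j
        simp only [Finsupp.coe_tsub, Pi.sub_apply, Finsupp.coe_equivFunOnFinite_symm, zOf]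
        have := hle' j; have := h j; omega
      rw [hidx]
    · rw [if_neg hle, if_neg]
      intro h'
      apply hle
      intro j
      have := h' j
      simp only [Pi.sub_apply, zOf] at this
      simp only [Finsupp.coe_equivFunOnFinite_symm]
      have := h j; omega
  · rw [if_neg h, if_neg]
    intro h'
    apply h
    intro j
    have := h' j
    simp only [Pi.sub_apply, zOf] at this
    omega

/-- Iterated monomial shift: `[r^c](r^{iα} · φ) = [r^{c − i•α}] φ`. -/
theorem coeffZ_monomial_pow_mul (c : Fin 5 → ℤ) (α : Fin 5 →₀ ℕ) (φ : S5) (i : ℕ) :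
    coeffZ c (monomial α (1 : ℤ) ^ i * φ) = coeffZ (c - i • zOf α) φ := by
  induction i generalizing c φ with
  | zero => simp
  | succ i ih =>
    rw [pow_succ, mul_assoc, ih, coeffZ_monomial_mul]
    congr 1
    funext j; simp only [Pi.sub_apply, Pi.smul_apply]; simp only [nsmul_eq_mul, Nat.cast_succ]; ring

/-- Negation passes through `coeffZ`. -/
theorem coeffZ_neg (c : Fin 5 → ℤ) (φ : S5) : coeffZ c (-φ) = -coeffZ c φ := by
  unfold coeffZ; split_ifs <;> simp

/-- `coeffZ c 0 = 0`. -/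
theorem coeffZ_zero (c : Fin 5 → ℤ) : coeffZ c 0 = 0 := by
  unfold coeffZ; split_ifs <;> simp

/-- Signs pass through `coeffZ`. -/
theorem coeffZ_neg_one_pow_mul (c : Fin 5 → ℤ) (φ : S5) (i : ℕ) :
    coeffZ c ((-1) ^ i * φ) = (-1) ^ i * coeffZ c φ := by
  induction i generalizing φ with
  | zero => simp
  | succ i ih =>
    rw [pow_succ, mul_assoc, ih, neg_one_mul, coeffZ_neg, pow_succ]; ring

/-- `coeffZ` of a finite sum. -/
theorem coeffZ_finset_sum (c : Fin 5 → ℤ) (s : Finset ℕ) (f : ℕ → S5) :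
    coeffZ c (∑ i ∈ s, f i) = ∑ i ∈ s, coeffZ c (f i) := by
  induction s using Finset.induction_on with
  | empty => simp [coeffZ_zero]
  | insert a s ha ih => rw [Finset.sum_insert ha, Finset.sum_insert ha, coeffZ_add, ih]

/-! ## The transfer lemma -/

section transfer

variable (α : Fin 5 →₀ ℕ) (W : S5) (U : S5ˣ) (hU : (U : S5) = 1 + monomial α (1 : ℤ) * W)
include hU

/-- Non-negative powers: `[r^c](U^n F) = 0` whenever all `[r^{c − iα}](W^i F)` vanish. -/
theorem coeffZ_pow_mul_eq_zero (n : ℕ) :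
    ∀ (F : S5) (c : Fin 5 → ℤ), (∀ i : ℕ, coeffZ (c - i • zOf α) (W ^ i * F) = 0) →
      coeffZ c ((U : S5) ^ n * F) = 0 := by
  induction n with
  | zero => intro F c h; simpa using h 0
  | succ n ih =>
    intro F c h
    have e : (U : S5) ^ (n + 1) * F = (U : S5) ^ n * F + monomial α (1 : ℤ) * ((U : S5) ^ n * (W * F)) := by
      rw [pow_succ, hU]; ring
    rw [e, coeffZ_add, ih F c h, coeffZ_monomial_mul, ih (W * F) (c - zOf α) fun i => ?_, add_zero]
    have := h (i + 1)
    rw [pow_succ] at this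
    convert this using 2
    · funext j; simp only [Pi.sub_apply, Pi.smul_apply]; simp only [nsmul_eq_mul, Nat.cast_succ]; ring
    · ring

/-- The inverse: `[r^c](U⁻¹ F) = 0` whenever all `[r^{c − iα}](W^i F)` vanish (`α ≠ 0`). -/
theorem coeffZ_inv_mul_eq_zero (hα : α ≠ 0) (F : S5) (c : Fin 5 → ℤ)
    (h : ∀ i : ℕ, coeffZ (c - i • zOf α) (W ^ i * F) = 0) : coeffZ c ((U⁻¹ : S5ˣ) * F) = 0 := by
  -- a coordinate where `α` is positive and a cut-off `K` beyond which the shifted exponent is negative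
  obtain ⟨j, hj⟩ : ∃ j, α j ≠ 0 := by
    by_contra hcon; push Not at hcon; exact hα (Finsupp.ext hcon)
  set K : ℕ := (c j).toNat + 1 with hK
  set x : S5 := -(monomial α (1 : ℤ) * W) with hx
  -- the finite geometric identity `U⁻¹ F = Σ_{i<K} x^i F + x^K U⁻¹ F`
  have hgeom : (∑ i ∈ range K, x ^ i) * (U : S5) = 1 - x ^ K := by
    rw [hU, show (1 : S5) + monomial α 1 * W = 1 - x by rw [hx]; ring]
    exact geom_sum_mul_neg x K
  have e : ((U⁻¹ : S5ˣ) : S5) * F = (∑ i ∈ range K, x ^ i * F) + x ^ K * (((U⁻¹ : S5ˣ) : S5) * F) := by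
    have hinv : (U : S5) * ((U⁻¹ : S5ˣ) : S5) = 1 := by rw [← Units.val_mul, mul_inv_cancel, Units.val_one]
    calc ((U⁻¹ : S5ˣ) : S5) * F = ((∑ i ∈ range K, x ^ i) * (U : S5) + x ^ K) * (((U⁻¹ : S5ˣ) : S5) * F) := by
          rw [hgeom]; ring
      _ = (∑ i ∈ range K, x ^ i) * ((U : S5) * ((U⁻¹ : S5ˣ) : S5)) * F + x ^ K * (((U⁻¹ : S5ˣ) : S5) * F) := by ring
      _ = (∑ i ∈ range K, x ^ i * F) + x ^ K * (((U⁻¹ : S5ˣ) : S5) * F) := by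
          rw [hinv, mul_one, Finset.sum_mul]
  rw [e, coeffZ_add]
  have hxi : ∀ (i : ℕ) (G : S5), coeffZ c (x ^ i * G) = (-1) ^ i * coeffZ (c - i • zOf α) (W ^ i * G) := by
    intro i G
    rw [hx, show (-(monomial α (1 : ℤ) * W)) ^ i * G = (-1) ^ i * (monomial α (1 : ℤ) ^ i * (W ^ i * G)) by
      rw [neg_pow, mul_pow]; ring, coeffZ_neg_one_pow_mul, coeffZ_monomial_pow_mul]
  have hsum : coeffZ c (∑ i ∈ range K, x ^ i * F) = 0 := by
    rw [coeffZ_finset_sum]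
    exact Finset.sum_eq_zero fun i _ => by rw [hxi, h i, mul_zero]
  have htail : coeffZ c (x ^ K * (((U⁻¹ : S5ˣ) : S5) * F)) = 0 := by
    rw [hxi]
    have hneg : (c - K • zOf α) j < 0 := by
      have h1 : (1 : ℤ) ≤ (α j : ℤ) := by exact_mod_cast Nat.one_le_iff_ne_zero.mpr hj
      have h2 : c j < (K : ℤ) := by simp only [hK]; omega
      have h3 : (K : ℤ) ≤ (K : ℤ) * (α j : ℤ) := le_mul_of_one_le_right (by positivity) h1
      simp only [Pi.sub_apply, Pi.smul_apply]
      simp only [nsmul_eq_mul, zOf]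
      linarith
    rw [coeffZ_eq_zero_of_neg _ hneg, mul_zero]
  rw [hsum, htail, add_zero]

/-- Negative powers: `[r^c](U^{−m} F) = 0` whenever all `[r^{c − iα}](W^i F)` vanish (`α ≠ 0`). -/
theorem coeffZ_inv_pow_mul_eq_zero (hα : α ≠ 0) (m : ℕ) :
    ∀ (F : S5) (c : Fin 5 → ℤ), (∀ i : ℕ, coeffZ (c - i • zOf α) (W ^ i * F) = 0) →
      coeffZ c (((U⁻¹ : S5ˣ) : S5) ^ m * F) = 0 := by
  induction m with
  | zero => intro F c h; simpa using h 0
  | succ m ih =>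
    intro F c h
    rw [pow_succ', mul_assoc]
    refine coeffZ_inv_mul_eq_zero α W U hU hα _ c fun i => ?_
    rw [show W ^ i * (((U⁻¹ : S5ˣ) : S5) ^ m * F) = ((U⁻¹ : S5ˣ) : S5) ^ m * (W ^ i * F) by ring]
    refine ih (W ^ i * F) (c - i • zOf α) fun k => ?_
    have := h (k + i)
    convert this using 2
    · funext l; simp only [Pi.sub_apply, Pi.smul_apply]; simp only [nsmul_eq_mul, Nat.cast_add]; ring
    · ring

/-- **TRANSFER LEMMA**: for `U = 1 + r^α W` (`α ≠ 0`) and any `N ∈ ℤ`, `[r^c](U^N F) = 0` as soon as every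
`[r^{c − iα}](W^i F)` (`i ≥ 0`) vanishes. -/
theorem coeffZ_zpow_mul_eq_zero (hα : α ≠ 0) (N : ℤ) (F : S5) (c : Fin 5 → ℤ)
    (h : ∀ i : ℕ, coeffZ (c - i • zOf α) (W ^ i * F) = 0) : coeffZ c (((U ^ N : S5ˣ) : S5) * F) = 0 := by
  rcases Int.eq_nat_or_neg N with ⟨m, rfl | rfl⟩
  · rw [zpow_natCast, Units.val_pow_eq_pow_val]
    exact coeffZ_pow_mul_eq_zero α W U hU m F c h
  · rw [zpow_neg, zpow_natCast, ← inv_pow, Units.val_pow_eq_pow_val]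
    exact coeffZ_inv_pow_mul_eq_zero α W U hU hα m F c h

end transfer

/-! ## Charts and the step theorem -/

/-- A chart `X^s = r^{γ s}·V(s)` is CT-TRIVIAL if the constant term of every non-trivial monomial vanishes. -/
def CTTrivial (γ : (Fin 5 → ℤ) →+ (Fin 5 → ℤ)) (V : Multiplicative (Fin 5 → ℤ) →* S5ˣ) : Prop :=
  ∀ s : Fin 5 → ℤ, s ≠ 0 → coeffZ (-(γ s)) (V (Multiplicative.ofAdd s) : S5) = 0

/-- The `r`-chart itself (`γ = id`, `V = 1`) is CT-trivial: `[r^{−s}] 1 = 0` for `s ≠ 0`. -/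
theorem ctTrivial_id : CTTrivial (AddMonoidHom.id _) 1 := by
  intro s hs
  rw [MonoidHom.one_apply, Units.val_one, coeffZ_one, if_neg]
  intro h; apply hs
  funext j; have := congrArg (fun f => f j) h; simp only [AddMonoidHom.id_apply, Pi.neg_apply,
    Pi.zero_apply, neg_eq_zero] at this; exact this

/-- The unit `1 + r^α·W` of an elementary step (`α ≠ 0`, so the constant coefficient is `1`). -/
theorem constantCoeff_one_add_monomial_mul (α : Fin 5 →₀ ℕ) (hα : α ≠ 0) (W : S5) :
    constantCoeff (1 + monomial α (1 : ℤ) * W) = ((1 : ℤˣ) : ℤ) := by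
  rw [map_add, map_one, map_mul, ← coeff_zero_eq_constantCoeff_apply, coeff_monomial, if_neg (Ne.symm hα),
    zero_mul, add_zero, Units.val_one]

/-- The unit `1 + r^α·W` as an element of `ℤ[[r]]ˣ`. -/
def stepUnit (α : Fin 5 →₀ ℕ) (hα : α ≠ 0) (W : S5) : S5ˣ :=
  ⟨1 + monomial α (1 : ℤ) * W, invOfUnit _ 1, mul_invOfUnit _ _ (constantCoeff_one_add_monomial_mul α hα W),
    invOfUnit_mul _ _ (constantCoeff_one_add_monomial_mul α hα W)⟩

/-- The value of `stepUnit`. -/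
@[simp] theorem val_stepUnit (α : Fin 5 →₀ ℕ) (hα : α ≠ 0) (W : S5) :
    ((stepUnit α hα W : S5ˣ) : S5) = 1 + monomial α (1 : ℤ) * W := rfl

/-- **STEP THEOREM**: CT-triviality propagates along an elementary change of chart `Y^s = X^{μ s}·(1 + X^ρ)^{a s}`
(`X^ρ` small, `μ` injective additive, `a` additive) under the flip condition `μ s + i•ρ = 0, i ≥ 1 ⇒ a s = 0`. -/
theorem ctTrivial_step (γ : (Fin 5 → ℤ) →+ (Fin 5 → ℤ)) (V : Multiplicative (Fin 5 → ℤ) →* S5ˣ)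
    (hX : CTTrivial γ V) (ρ : Fin 5 → ℤ) (α : Fin 5 →₀ ℕ) (hα : α ≠ 0) (hρ : γ ρ = zOf α)
    (μ : (Fin 5 → ℤ) →+ (Fin 5 → ℤ)) (hμ : Function.Injective μ) (a : (Fin 5 → ℤ) →+ ℤ)
    (hflip : ∀ (s : Fin 5 → ℤ) (i : ℕ), 1 ≤ i → μ s + i • ρ = 0 → a s = 0)
    (U : S5ˣ) (hU : (U : S5) = 1 + monomial α (1 : ℤ) * (V (Multiplicative.ofAdd ρ) : S5)) :
    ∀ s : Fin 5 → ℤ, s ≠ 0 →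
      coeffZ (-(γ (μ s))) ((V (Multiplicative.ofAdd (μ s)) : S5) * ((U ^ (a s) : S5ˣ) : S5)) = 0 := by
  intro s hs
  have hμs : μ s ≠ 0 := fun h => hs (hμ (by rw [h, map_zero]))
  by_cases hN : a s = 0
  · rw [hN, zpow_zero, Units.val_one, mul_one]
    exact hX (μ s) hμs
  · rw [mul_comm]
    refine coeffZ_zpow_mul_eq_zero α (V (Multiplicative.ofAdd ρ) : S5) U hU hα (a s) _ _ fun i => ?_
    have hV : (V (Multiplicative.ofAdd ρ) : S5) ^ i * (V (Multiplicative.ofAdd (μ s)) : S5) =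
        (V (Multiplicative.ofAdd (μ s + i • ρ)) : S5) := by
      rw [ofAdd_add, map_mul, Units.val_mul, ofAdd_nsmul, map_pow, Units.val_pow_eq_pow_val, mul_comm]
    have hγ : -(γ (μ s)) - i • zOf α = -(γ (μ s + i • ρ)) := by
      rw [map_add, map_nsmul, hρ]; abel
    rw [hV, hγ]
    by_cases hz : μ s + i • ρ = 0
    · exfalso
      have hi : 1 ≤ i := by
        rcases Nat.eq_zero_or_pos i with h0 | h0
        · subst h0; simp at hz; exact absurd hz hμs
        · exact h0
      exact hN (hflip s i hi hz)
    · exact hX _ hz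

end DualR

end Summit.KontsevichZagierPeriods.Zeta5Search.Families.Cellular
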